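import Summits.MatrixMultiplication.MatrixMultiplication.Theses.ThinBlockAlpha
import Summits.MatrixMultiplication.MatrixMultiplication.Theorems.ThinPackings.Negative.ThinPackingsPacking
import Summits.MatrixMultiplication.MatrixMultiplication.Theorems.ThinPackings.Negative.ThinPackingsStrengtheningsFalse
import Summits.MatrixMultiplication.MatrixMultiplication.Theorems.ThinPackings.Negative.ThinPackingsReduction
import Summits.MatrixMultiplication.MatrixMultiplication.Theorems.ThinBlockAlphaThinPackingsStubCosetTiles
import Summits.MatrixMultiplication.MatrixMultiplication.Theorems.ThinBlockAlphaThinPackingsStubBlockTPP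
import Summits.MatrixMultiplication.MatrixMultiplication.Theorems.ThinBlockAlphaThinPackingsStubTransfer

set_option linter.dupNamespace false

/-!
# Line `log-flat-cyclic-designs` for the crux `ThinBlockAlpha.ThinPackings` (stmt-MatrixMultiplication-10595)

Skeleton (crux-plan, round 1, 2026-08-16).  Host: the CYCLIC group `Additive Fˣ`, `F = 𝔽_{p^m}`; legs are
discrete-log images of affine `𝔽_p`-segments.  Block `i` is

  `A_i = x_i + 𝔽_p^×`,   `B_i = y_i + ξ_i·𝒮` (`𝒮 ⊆ 𝔽_p^×`, `|𝒮| ≥ (p-1)^a` — the THIN leg),   `C_i = x_i + ζ·𝔽_p^×`,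

so every STPP pattern `(i,j,k)` (tree `IsSTPP`, `(s'−s)+(t'−t)+(u'−u)=0` in `Additive Fˣ`) is ONE field identity

  `(x_i+τ')(y_j+ξ_jσ')(x_k+ζρ') = (x_k+τ)(y_i+ξ_iσ)(x_j+ζρ)`     (`τ,τ',ρ,ρ' ∈ 𝔽_p^×`, `σ,σ' ∈ 𝒮`).

What this skeleton fixes, beyond the idea card (triage sharpenings r1-1/2/3 applied: THIN target, not the square
`LogFlatTight`): the A/C geometry.  With `ζ` QUADRATIC over `𝔽_p` (`K₀ := 𝔽_p(ζ) ≅ 𝔽_{p²}`) and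
`x_i = s_i + γ_i`, `γ_i ∈ K₀`, `s_i` running over `K₀`-projectively distinct points off `K₀` (a COSET DESIGN
`X = S + K₀`), the whole A–C layer is EXACT: the tiles `(x+𝔽_p^×)/(x+ζ𝔽_p^×)` are pairwise disjoint of full size
`(p−1)²` (`stub_cosetTiles`, provable `K₀`-linear algebra), with `|X| = (p^m − p²)/(p² − 1)`, i.e. two-leg slack
`(p+1)/(p−1) → 1` — so the card's "cheapest falsifier (a)" (log-Sidon tiles cannot nearly tile `F^×`) is FALSE, and
the design problem is entirely about the short legs `B_i` (free data `y_i, ξ_i ∈ F` per block): `stub_cosetDesign`.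

Stubs (registered; `sorry` only inside them):
* `stub_cosetTiles`   — A–C layer of coset designs is exact (provable now, M).
* `stub_blockTPP`     — generic single-block TPP from `𝔽_p`-independence of 7 products (provable now, S/M).
* `stub_cosetDesign`  — THE HEART (open, XL): B-legs for a coset design killing every B-involving off-diagonal
                         pattern, thin middle `|𝒮| ≥ (p−1)^a`, numerology `|F|−1 ≤ L(p−1)^{2+η}`.
* `stub_transfer`     — packaging of a multiplicatively-STPP unit-valued segment configuration (general
                         `x y z ξ ζ`, inlined `MulSTPP`) into an `IsSTPP` family of `Additive Fˣ` with cardinalities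
                         `p−1, |𝒮|, p−1` (provable now, M).  LEAD RESHAPE v2 (2026-08-16, lead c1): the stub is now
                         self-contained over Mathlib + tree constants (v1 stated it through the file-local
                         `LogFlatThin → ThinPackings`, which cannot be landed under `Theorems/`); the real-number
                         bookkeeping (`N = p−1 ≥ 2`, `N^a ≤ M`, `|Additive Fˣ| = |F|−1 ≤ L·N^{2+η}`) moved into the glue.
`ThinPackings_of : stub_cosetDesign → stub_cosetTiles → stub_blockTPP → stub_transfer → ThinPackings` is proved
below without `sorry` (case split on the pattern: diagonal ↦ TPP, `i=j ∧ σ=σ'` ↦ tiles, the rest ↦ design; then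
`stub_transfer` + `Fintype.card_units`).

STATUS / PLANNER'S WARNING (read before building; details and data in `Lines/log-flat-cyclic-designs.md` §Status):
the planner believes `stub_cosetDesign` — and more generally `LogFlatThin` for ANY segment configuration — is FALSE,
by a SUM–PRODUCT COVERING OBSTRUCTION found while planning: Katz's bound makes every cross set `C_j/A_i` (ratio of two
shifted prime-field segments) multiplicatively Fourier-flat (bias `≤ ((m−1)√p+1)²/(p−1)² ≈ m²/p`), two-leg tightness
makes the tile union `U = ⋃_k A_k/C_k` dense (`≥ (p−1)^{−η}`), hence `U·(C_j/A_i)` misses at most an `O(m⁴ p^{η−2})`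
fraction `W_ij` of `Fˣ`, while STPP pattern `(i,j,k)` summed over `k` forces `B_j/B_i ⊆ W_ij` for every ordered pair
`i ≠ j` (rigorous); numerically (`calc/coset_cover.py`, `calc/coset_bsearch.py` at `(p,m) = (5,6)`) the sets `W_ij` are
structureless (random-model sizes to 3 digits) and even singleton middle legs (`M = 1`) cannot be placed on more than
2–4 of the ≥ 113 blocks a tight family needs.  The skeleton is published because (i) it is mechanically sound and its
three provable stubs are true, (ii) the registered heart gives the disprover a precise target (`¬ CosetDesignStatement`,
better `¬ LogFlatThin`, best the general "flat legs" Negative lemma stated in the card), and (iii) the exact A–C layer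
(`stub_cosetTiles`) is a reusable positive result.  Recommended first cycle: prove the no-go, not the design.

Disproof.lean used (cdisprove gen 1; the landed `Negative/*` files are imported so the scratch check sees them):
no `_false_without_` theorem exists for this crux.  Honoured: `Negative.two_le_M`/`one_le_M` (design asks
`(p−1)^a ≤ |𝒮|`, `0 ∉ 𝒮`), `Negative.not_thinPackingsBoundedN` (`N = p−1 → ∞` is free), `not_thinPackingsExact`
(slack `(p+1)/(p−1) > 1` even at the tile layer), `not_thinPackingsBoundedExponent` (host cyclic of order `p^m−1`),
`Negative.M_le` (forces `p − 1 ≥ (2 − o(1))^{1/η}`: recorded as a side condition of the design stub's numerology),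
`thinPackings_false_of_not_cThesis` (any witness is ≥ X_C-hard: conceded, this is a design programme).
-/

namespace Summit.MatrixMultiplication.MatrixMultiplication.Cruxes.ThinPackings.LogFlatCyclicDesigns

open Literature.Computability.AlgebraicComplexity
open Summit.MatrixMultiplication.MatrixMultiplication.Theses.ThinBlockAlpha (ThinPackings)

/-! ## Vocabulary (transparent `Prop`s; the registered stubs below are exactly these) -/

/-- **Multiplicative STPP of a segment configuration.**  Block `i` of a configuration
`(x, y, z, ξ, ζ : Fin L → F, 𝒮 ⊆ ZMod p)` has legs `x i + 𝔽_p^×`, `y i + ξ i · 𝒮`, `z i + ζ i · 𝔽_p^×`; this is the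
tree predicate `IsSTPP` read in the cyclic group `Additive Fˣ` (same index convention: `s ∈ A k`, `s' ∈ A i`,
`t ∈ B i`, `t' ∈ B j`, `u ∈ C j`, `u' ∈ C k`, and `(s'−s)+(t'−t)+(u'−u)=0 ⟺ s'·t'·u' = s·t·u`). -/
def MulSTPP (p : ℕ) (F : Type) [Field F] [Algebra (ZMod p) F] {L : ℕ}
    (x y z ξ ζ : Fin L → F) (S : Finset (ZMod p)) : Prop :=
  ∀ i j k : Fin L, ∀ τ τ' σ σ' ρ ρ' : ZMod p, τ ≠ 0 → τ' ≠ 0 → ρ ≠ 0 → ρ' ≠ 0 → σ ∈ S → σ' ∈ S →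
    (x i + algebraMap (ZMod p) F τ') * (y j + ξ j * algebraMap (ZMod p) F σ') *
        (z k + ζ k * algebraMap (ZMod p) F ρ') =
      (x k + algebraMap (ZMod p) F τ) * (y i + ξ i * algebraMap (ZMod p) F σ) *
        (z j + ζ j * algebraMap (ZMod p) F ρ) →
    i = j ∧ j = k ∧ τ = τ' ∧ σ = σ' ∧ ρ = ρ'

/-- **`C⁺_a` — the THIN log-flat target in field arithmetic** (triage r1-2/r1-3 sharpening of the card's square
`LogFlatTight`): for every shape exponent `a < 1` and slack `η > 0` some segment configuration over a finite field of
odd prime characteristic `p` is multiplicatively STPP, nondegenerate (every leg element is a unit, legs have full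
size), has a thin middle box `(p−1)^a ≤ |𝒮|`, `0 ∉ 𝒮`, and is two-leg tight: `|F| − 1 ≤ L·(p−1)^{2+η}`.
`stub_transfer` turns it into the crux with `H = Additive Fˣ`, `N = p − 1`, `M = |𝒮|`. -/
def LogFlatThin : Prop :=
  ∀ a : ℝ, 0 ≤ a → a < 1 → ∀ η : ℝ, 0 < η →
    ∃ (p : ℕ) (F : Type) (_ : Field F) (_ : Fintype F) (_ : Algebra (ZMod p) F) (L : ℕ)
      (x y z ξ ζ : Fin L → F) (S : Finset (ZMod p)),
      p.Prime ∧ 3 ≤ p ∧ (0 : ZMod p) ∉ S ∧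
      (∀ i, ξ i ≠ 0 ∧ ζ i ≠ 0) ∧
      (∀ i (c : ZMod p), x i + algebraMap (ZMod p) F c ≠ 0 ∧
        y i + ξ i * algebraMap (ZMod p) F c ≠ 0 ∧ z i + ζ i * algebraMap (ZMod p) F c ≠ 0) ∧
      MulSTPP p F x y z ξ ζ S ∧
      (((p - 1 : ℕ) : ℝ) ^ a ≤ S.card) ∧
      (((Fintype.card F - 1 : ℕ) : ℝ) ≤ L * ((p - 1 : ℕ) : ℝ) ^ (2 + η))

/-- Statement of `stub_transfer` (lead reshape v2, 2026-08-16: self-contained over Mathlib + tree constants, so the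
registered signature can be landed under `Theorems/`; the real-number bookkeeping moved into `ThinPackings_of`):
**packaging of a multiplicatively-STPP unit-valued segment configuration into `Additive Fˣ`.**  For a prime `p`, a
finite field `F ⊇ 𝔽_p`, a configuration `(x, y, z, ξ, ζ : Fin L → F, 𝒮 ⊆ 𝔽_p)` with `0 ∉ 𝒮`, nonzero directions,
unit-valued legs and the multiplicative STPP (`MulSTPP`, inlined), there is an `IsSTPP` family in the cyclic group
`Additive Fˣ` with `|A i| = |C i| = p − 1` and `|B i| = |𝒮|` (legs = images of `𝔽_p^×`, `𝒮`, `𝔽_p^×` under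
`c ↦ x i + c`, `c ↦ y i + ξ i c`, `c ↦ z i + ζ i c`, read in `Fˣ`). -/
def TransferStatement : Prop :=
  ∀ (p : ℕ) (F : Type) [Field F] [Fintype F] [Algebra (ZMod p) F] (L : ℕ)
    (x y z ξ ζ : Fin L → F) (S : Finset (ZMod p)),
    p.Prime → (0 : ZMod p) ∉ S →
    (∀ i, ξ i ≠ 0 ∧ ζ i ≠ 0) →
    (∀ i (c : ZMod p), x i + algebraMap (ZMod p) F c ≠ 0 ∧
      y i + ξ i * algebraMap (ZMod p) F c ≠ 0 ∧ z i + ζ i * algebraMap (ZMod p) F c ≠ 0) →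
    (∀ i j k : Fin L, ∀ τ τ' σ σ' ρ ρ' : ZMod p, τ ≠ 0 → τ' ≠ 0 → ρ ≠ 0 → ρ' ≠ 0 → σ ∈ S → σ' ∈ S →
      (x i + algebraMap (ZMod p) F τ') * (y j + ξ j * algebraMap (ZMod p) F σ') *
          (z k + ζ k * algebraMap (ZMod p) F ρ') =
        (x k + algebraMap (ZMod p) F τ) * (y i + ξ i * algebraMap (ZMod p) F σ) *
          (z j + ζ j * algebraMap (ZMod p) F ρ) →
      i = j ∧ j = k ∧ τ = τ' ∧ σ = σ' ∧ ρ = ρ') →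
    ∃ (A B C : Fin L → Finset (Additive Fˣ)),
      Literature.Computability.AlgebraicComplexity.IsSTPP A B C ∧
      ∀ i, (A i).card = p - 1 ∧ (B i).card = S.card ∧ (C i).card = p - 1

/-- Statement of `stub_blockTPP` — **generic single-block TPP**: if the seven products
`x y ζ, x ξ z, x ξ ζ, y z, y ζ, ξ z, ξ ζ` are `𝔽_p`-linearly independent then the box map
`(τ, σ, ρ) ↦ (x+τ)(y+ξσ)(z+ζρ)` is injective on `(ZMod p)³` (expand: the product is `x y z` plus the combination
of the seven with coefficients `ρ, σ, σρ, τ, τρ, τσ, τσρ`). -/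
def BlockTPPStatement : Prop :=
  ∀ (p : ℕ) (F : Type) [Field F] [Algebra (ZMod p) F] (x y z ξ ζ : F),
    LinearIndependent (ZMod p) ![x * y * ζ, x * ξ * z, x * ξ * ζ, y * z, y * ζ, ξ * z, ξ * ζ] →
    ∀ τ τ' σ σ' ρ ρ' : ZMod p,
      (x + algebraMap (ZMod p) F τ') * (y + ξ * algebraMap (ZMod p) F σ') *
          (z + ζ * algebraMap (ZMod p) F ρ') =
        (x + algebraMap (ZMod p) F τ) * (y + ξ * algebraMap (ZMod p) F σ) *
          (z + ζ * algebraMap (ZMod p) F ρ) →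
      τ = τ' ∧ σ = σ' ∧ ρ = ρ'

/-- Statement of `stub_cosetTiles` — **the A–C layer of a coset design is exact.**  Data: `ζ` quadratic over
`𝔽_p` (`ζ² = u + vζ`), base points `x i = s i + (g i + h i·ζ)` with `s i ∉ K₀ := 𝔽_p + 𝔽_pζ` (independence of
`1, ζ, s i, ζ s i`), distinct `s`-values `K₀`-independent together with `1` (independence of
`1, ζ, s i, ζ s i, s k, ζ s k`), and `i ↦ (s i, g i, h i)` injective.  Conclusion: a tile collision
`(x_i+τ')(x_k+ζρ') = (x_k+τ)(x_i+ζρ)` (box variables nonzero) forces `i = k`, `τ = τ'`, `ρ = ρ'`.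
Proof (NOTES/line card): the identity is `K₀`-LINEAR in `x_i, x_k`:
`x_i(ζρ'−τ) + x_k(τ'−ζρ) + ζ(τ'ρ'−τρ) = 0`; read off coefficients of `s, ζs` (and of `s_k, ζs_k`). -/
def CosetTilesStatement : Prop :=
  ∀ (p : ℕ) (F : Type) [Field F] [Algebra (ZMod p) F] (ζ : F) (u v : ZMod p),
    ζ * ζ = algebraMap (ZMod p) F u + algebraMap (ZMod p) F v * ζ →
    ∀ (L : ℕ) (s : Fin L → F) (g h : Fin L → ZMod p),
      (∀ i, LinearIndependent (ZMod p) ![(1 : F), ζ, s i, ζ * s i]) →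
      (∀ i k, s i ≠ s k → LinearIndependent (ZMod p) ![(1 : F), ζ, s i, ζ * s i, s k, ζ * s k]) →
      (∀ i k, s i = s k → g i = g k → h i = h k → i = k) →
      ∀ (i k : Fin L) (τ τ' ρ ρ' : ZMod p), τ ≠ 0 → τ' ≠ 0 → ρ ≠ 0 → ρ' ≠ 0 →
        (s i + (algebraMap (ZMod p) F (g i) + algebraMap (ZMod p) F (h i) * ζ) + algebraMap (ZMod p) F τ') *
            (s k + (algebraMap (ZMod p) F (g k) + algebraMap (ZMod p) F (h k) * ζ) +
              ζ * algebraMap (ZMod p) F ρ') =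
          (s k + (algebraMap (ZMod p) F (g k) + algebraMap (ZMod p) F (h k) * ζ) + algebraMap (ZMod p) F τ) *
            (s i + (algebraMap (ZMod p) F (g i) + algebraMap (ZMod p) F (h i) * ζ) +
              ζ * algebraMap (ZMod p) F ρ) →
        i = k ∧ τ = τ' ∧ ρ = ρ'

/-- Statement of `stub_cosetDesign` — **THE HEART (open): short legs for a coset design.**  For every `a < 1`,
`η > 0`: an odd prime `p`, a finite field `F ⊇ 𝔽_p`, `ζ` quadratic over `𝔽_p`, coset-design base points
`x i = s i + (g i + h i ζ)` (hypotheses of `CosetTilesStatement`), FREE short-leg data `y i, ξ i : F` and a thin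
middle box `𝒮 ⊆ 𝔽_p^×`, `(p−1)^a ≤ |𝒮|`, such that
(T) each block's seven products are `𝔽_p`-independent (feeds `stub_blockTPP`, here with `z = x`, `ζ i = ζ`);
(N) nondegeneracy: `ξ i ≠ 0`, `y i + ξ i c ≠ 0`, `x i + c ≠ 0`, `x i + ζ c ≠ 0` for all `c ∈ 𝔽_p`;
(OFF) every B-involving off-diagonal pattern instance fails: for `(i ≠ j) ∨ (j ≠ k ∧ σ ≠ σ')`,
  `(x_i+τ')(y_j+ξ_jσ')(x_k+ζρ') ≠ (x_k+τ)(y_i+ξ_iσ)(x_j+ζρ)`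
  (the complementary instances are the diagonal `i=j=k` — TPP — and `i=j, σ=σ'` — the A–C tiles);
(SIZE) `|F| − 1 ≤ L·(p−1)^{2+η}` (forces `|X| ≥ p^{m−2}(p−1)^{−η}(1+O(1/p))`: both the set of `K₀`-lines used and
  the set `Γ` of `γ`'s per coset must have density `≥ (p−1)^{−η}`; and `p − 1 ≥ 2^{1/η}` by `Negative.M_le`). -/
def CosetDesignStatement : Prop :=
  ∀ a : ℝ, 0 ≤ a → a < 1 → ∀ η : ℝ, 0 < η →
    ∃ (p : ℕ) (F : Type) (_ : Field F) (_ : Fintype F) (_ : Algebra (ZMod p) F) (ζ : F) (u v : ZMod p)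
      (L : ℕ) (s : Fin L → F) (g h : Fin L → ZMod p) (y ξ : Fin L → F) (S : Finset (ZMod p)),
      p.Prime ∧ 3 ≤ p ∧ (0 : ZMod p) ∉ S ∧ (((p - 1 : ℕ) : ℝ) ^ a ≤ S.card) ∧
      ζ * ζ = algebraMap (ZMod p) F u + algebraMap (ZMod p) F v * ζ ∧
      (∀ i, LinearIndependent (ZMod p) ![(1 : F), ζ, s i, ζ * s i]) ∧
      (∀ i k, s i ≠ s k → LinearIndependent (ZMod p) ![(1 : F), ζ, s i, ζ * s i, s k, ζ * s k]) ∧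
      (∀ i k, s i = s k → g i = g k → h i = h k → i = k) ∧
      (∀ i, LinearIndependent (ZMod p)
        ![(s i + (algebraMap (ZMod p) F (g i) + algebraMap (ZMod p) F (h i) * ζ)) * y i * ζ,
          (s i + (algebraMap (ZMod p) F (g i) + algebraMap (ZMod p) F (h i) * ζ)) * ξ i *
            (s i + (algebraMap (ZMod p) F (g i) + algebraMap (ZMod p) F (h i) * ζ)),
          (s i + (algebraMap (ZMod p) F (g i) + algebraMap (ZMod p) F (h i) * ζ)) * ξ i * ζ,
          y i * (s i + (algebraMap (ZMod p) F (g i) + algebraMap (ZMod p) F (h i) * ζ)),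
          y i * ζ,
          ξ i * (s i + (algebraMap (ZMod p) F (g i) + algebraMap (ZMod p) F (h i) * ζ)),
          ξ i * ζ]) ∧
      (∀ i, ξ i ≠ 0) ∧
      (∀ i (c : ZMod p),
        s i + (algebraMap (ZMod p) F (g i) + algebraMap (ZMod p) F (h i) * ζ) + algebraMap (ZMod p) F c ≠ 0 ∧
        y i + ξ i * algebraMap (ZMod p) F c ≠ 0 ∧
        s i + (algebraMap (ZMod p) F (g i) + algebraMap (ZMod p) F (h i) * ζ) +
          ζ * algebraMap (ZMod p) F c ≠ 0) ∧
      (∀ (i j k : Fin L) (τ τ' σ σ' ρ ρ' : ZMod p), τ ≠ 0 → τ' ≠ 0 → ρ ≠ 0 → ρ' ≠ 0 → σ ∈ S → σ' ∈ S →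
        (i ≠ j ∨ (j ≠ k ∧ σ ≠ σ')) →
        (s i + (algebraMap (ZMod p) F (g i) + algebraMap (ZMod p) F (h i) * ζ) + algebraMap (ZMod p) F τ') *
            (y j + ξ j * algebraMap (ZMod p) F σ') *
            (s k + (algebraMap (ZMod p) F (g k) + algebraMap (ZMod p) F (h k) * ζ) +
              ζ * algebraMap (ZMod p) F ρ') ≠
          (s k + (algebraMap (ZMod p) F (g k) + algebraMap (ZMod p) F (h k) * ζ) + algebraMap (ZMod p) F τ) *
            (y i + ξ i * algebraMap (ZMod p) F σ) *
            (s j + (algebraMap (ZMod p) F (g j) + algebraMap (ZMod p) F (h j) * ζ) +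
              ζ * algebraMap (ZMod p) F ρ)) ∧
      (((Fintype.card F - 1 : ℕ) : ℝ) ≤ L * ((p - 1 : ℕ) : ℝ) ^ (2 + η))

/-! ## The registered stubs (`sorry` lives only in these four theorems; each restates its named statement
VERBATIM, so the registered signatures are self-contained formulas over Mathlib and tree declarations) -/

/-- **STUB · `stub_cosetDesign`** (= `CosetDesignStatement` verbatim) — the load-bearing, OPEN step: decorate the
exact A–C skeleton `X = S + K₀` with short legs `B_i = y_i + ξ_i 𝒮`.  Size XL / open (≥ the whole crux in
difficulty for this family).  First-moment law to beat: random `(y_i, ξ_i)` violate `p^{2+2a−η}` pair instances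
and `p^{m+2a−2η}` all-distinct instances per block; dead sub-choices recorded in the line card (B-legs inside the
coset `x_i + K₀` reduce cross-coset patterns to quadratic `K₀`-independence of the transversal — capped; graded /
subfield-valued coordinates — A–B tile cap `L ≤ q²/M`). -/
theorem stub_cosetDesign :
    ∀ a : ℝ, 0 ≤ a → a < 1 → ∀ η : ℝ, 0 < η →
      ∃ (p : ℕ) (F : Type) (_ : Field F) (_ : Fintype F) (_ : Algebra (ZMod p) F) (ζ : F) (u v : ZMod p)
        (L : ℕ) (s : Fin L → F) (g h : Fin L → ZMod p) (y ξ : Fin L → F) (S : Finset (ZMod p)),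
        p.Prime ∧ 3 ≤ p ∧ (0 : ZMod p) ∉ S ∧ (((p - 1 : ℕ) : ℝ) ^ a ≤ S.card) ∧
        ζ * ζ = algebraMap (ZMod p) F u + algebraMap (ZMod p) F v * ζ ∧
        (∀ i, LinearIndependent (ZMod p) ![(1 : F), ζ, s i, ζ * s i]) ∧
        (∀ i k, s i ≠ s k → LinearIndependent (ZMod p) ![(1 : F), ζ, s i, ζ * s i, s k, ζ * s k]) ∧
        (∀ i k, s i = s k → g i = g k → h i = h k → i = k) ∧
        (∀ i, LinearIndependent (ZMod p)
          ![(s i + (algebraMap (ZMod p) F (g i) + algebraMap (ZMod p) F (h i) * ζ)) * y i * ζ,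
            (s i + (algebraMap (ZMod p) F (g i) + algebraMap (ZMod p) F (h i) * ζ)) * ξ i *
              (s i + (algebraMap (ZMod p) F (g i) + algebraMap (ZMod p) F (h i) * ζ)),
            (s i + (algebraMap (ZMod p) F (g i) + algebraMap (ZMod p) F (h i) * ζ)) * ξ i * ζ,
            y i * (s i + (algebraMap (ZMod p) F (g i) + algebraMap (ZMod p) F (h i) * ζ)),
            y i * ζ,
            ξ i * (s i + (algebraMap (ZMod p) F (g i) + algebraMap (ZMod p) F (h i) * ζ)),
            ξ i * ζ]) ∧
        (∀ i, ξ i ≠ 0) ∧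
        (∀ i (c : ZMod p),
          s i + (algebraMap (ZMod p) F (g i) + algebraMap (ZMod p) F (h i) * ζ) + algebraMap (ZMod p) F c ≠ 0 ∧
          y i + ξ i * algebraMap (ZMod p) F c ≠ 0 ∧
          s i + (algebraMap (ZMod p) F (g i) + algebraMap (ZMod p) F (h i) * ζ) +
            ζ * algebraMap (ZMod p) F c ≠ 0) ∧
        (∀ (i j k : Fin L) (τ τ' σ σ' ρ ρ' : ZMod p), τ ≠ 0 → τ' ≠ 0 → ρ ≠ 0 → ρ' ≠ 0 → σ ∈ S → σ' ∈ S →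
          (i ≠ j ∨ (j ≠ k ∧ σ ≠ σ')) →
          (s i + (algebraMap (ZMod p) F (g i) + algebraMap (ZMod p) F (h i) * ζ) + algebraMap (ZMod p) F τ') *
              (y j + ξ j * algebraMap (ZMod p) F σ') *
              (s k + (algebraMap (ZMod p) F (g k) + algebraMap (ZMod p) F (h k) * ζ) +
                ζ * algebraMap (ZMod p) F ρ') ≠
            (s k + (algebraMap (ZMod p) F (g k) + algebraMap (ZMod p) F (h k) * ζ) + algebraMap (ZMod p) F τ) *
              (y i + ξ i * algebraMap (ZMod p) F σ) *
              (s j + (algebraMap (ZMod p) F (g j) + algebraMap (ZMod p) F (h j) * ζ) +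
                ζ * algebraMap (ZMod p) F ρ)) ∧
        (((Fintype.card F - 1 : ℕ) : ℝ) ≤ L * ((p - 1 : ℕ) : ℝ) ^ (2 + η)) := by
  sorry

/-- **STUB · `stub_cosetTiles`** (= `CosetTilesStatement` verbatim) — provable now (M): `K₀`-linear algebra, see the
docstring of `CosetTilesStatement`. -/
theorem stub_cosetTiles :
    ∀ (p : ℕ) (F : Type) [Field F] [Algebra (ZMod p) F] (ζ : F) (u v : ZMod p),
      ζ * ζ = algebraMap (ZMod p) F u + algebraMap (ZMod p) F v * ζ →
      ∀ (L : ℕ) (s : Fin L → F) (g h : Fin L → ZMod p),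
        (∀ i, LinearIndependent (ZMod p) ![(1 : F), ζ, s i, ζ * s i]) →
        (∀ i k, s i ≠ s k → LinearIndependent (ZMod p) ![(1 : F), ζ, s i, ζ * s i, s k, ζ * s k]) →
        (∀ i k, s i = s k → g i = g k → h i = h k → i = k) →
        ∀ (i k : Fin L) (τ τ' ρ ρ' : ZMod p), τ ≠ 0 → τ' ≠ 0 → ρ ≠ 0 → ρ' ≠ 0 →
          (s i + (algebraMap (ZMod p) F (g i) + algebraMap (ZMod p) F (h i) * ζ) + algebraMap (ZMod p) F τ') *
              (s k + (algebraMap (ZMod p) F (g k) + algebraMap (ZMod p) F (h k) * ζ) +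
                ζ * algebraMap (ZMod p) F ρ') =
            (s k + (algebraMap (ZMod p) F (g k) + algebraMap (ZMod p) F (h k) * ζ) + algebraMap (ZMod p) F τ) *
              (s i + (algebraMap (ZMod p) F (g i) + algebraMap (ZMod p) F (h i) * ζ) +
                ζ * algebraMap (ZMod p) F ρ) →
          i = k ∧ τ = τ' ∧ ρ = ρ' :=
  -- LANDED (wave 1, 2026-08-16): kernel-checked in the tree
  Summit.MatrixMultiplication.MatrixMultiplication.Theorems.ThinPackings.stub_cosetTiles

/-- **STUB · `stub_blockTPP`** (= `BlockTPPStatement` verbatim) — provable now (S/M): expand and compare the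
coefficient vectors `(ρ, σ, σρ, τ, τρ, τσ, τσρ)` via `LinearIndependent`. -/
theorem stub_blockTPP :
    ∀ (p : ℕ) (F : Type) [Field F] [Algebra (ZMod p) F] (x y z ξ ζ : F),
      LinearIndependent (ZMod p) ![x * y * ζ, x * ξ * z, x * ξ * ζ, y * z, y * ζ, ξ * z, ξ * ζ] →
      ∀ τ τ' σ σ' ρ ρ' : ZMod p,
        (x + algebraMap (ZMod p) F τ') * (y + ξ * algebraMap (ZMod p) F σ') *
            (z + ζ * algebraMap (ZMod p) F ρ') =
          (x + algebraMap (ZMod p) F τ) * (y + ξ * algebraMap (ZMod p) F σ) *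
            (z + ζ * algebraMap (ZMod p) F ρ) →
        τ = τ' ∧ σ = σ' ∧ ρ = ρ' :=
  -- LANDED (wave 1, 2026-08-16): kernel-checked in the tree
  Summit.MatrixMultiplication.MatrixMultiplication.Theorems.ThinPackings.stub_blockTPP

/-- **STUB · `stub_transfer`** (= `TransferStatement` verbatim; lead reshape v2) — provable now (M):
legs are the images of `𝔽_p^×`, `𝒮`, `𝔽_p^×` under the injective maps `c ↦ x i + c`, `c ↦ y i + ξ i c`,
`c ↦ z i + ζ i c` into units (`Units.mk0`, nondegeneracy; `algebraMap (ZMod p) F` is injective as `ZMod p` is a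
field for `p` prime), so `|A i| = |C i| = p − 1` (`(univ.filter (· ≠ 0)).card = p − 1`), `|B i| = |𝒮|`; `IsSTPP`
is the multiplicative STPP read through `Additive.ofMul`/`toMul` (`(s'−s)+(t'−t)+(u'−u) = 0` in `Additive Fˣ`
`⟺ s'·t'·u' = s·t·u` in `Fˣ` `⟺` the field identity, by `Units.ext`). -/
theorem stub_transfer :
    ∀ (p : ℕ) (F : Type) [Field F] [Fintype F] [Algebra (ZMod p) F] (L : ℕ)
      (x y z ξ ζ : Fin L → F) (S : Finset (ZMod p)),
      p.Prime → (0 : ZMod p) ∉ S →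
      (∀ i, ξ i ≠ 0 ∧ ζ i ≠ 0) →
      (∀ i (c : ZMod p), x i + algebraMap (ZMod p) F c ≠ 0 ∧
        y i + ξ i * algebraMap (ZMod p) F c ≠ 0 ∧ z i + ζ i * algebraMap (ZMod p) F c ≠ 0) →
      (∀ i j k : Fin L, ∀ τ τ' σ σ' ρ ρ' : ZMod p, τ ≠ 0 → τ' ≠ 0 → ρ ≠ 0 → ρ' ≠ 0 → σ ∈ S → σ' ∈ S →
        (x i + algebraMap (ZMod p) F τ') * (y j + ξ j * algebraMap (ZMod p) F σ') *
            (z k + ζ k * algebraMap (ZMod p) F ρ') =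
          (x k + algebraMap (ZMod p) F τ) * (y i + ξ i * algebraMap (ZMod p) F σ) *
            (z j + ζ j * algebraMap (ZMod p) F ρ) →
        i = j ∧ j = k ∧ τ = τ' ∧ σ = σ' ∧ ρ = ρ') →
      ∃ (A B C : Fin L → Finset (Additive Fˣ)),
        Literature.Computability.AlgebraicComplexity.IsSTPP A B C ∧
        ∀ i, (A i).card = p - 1 ∧ (B i).card = S.card ∧ (C i).card = p - 1 :=
  -- LANDED (wave 1, 2026-08-16): kernel-checked in the tree
  Summit.MatrixMultiplication.MatrixMultiplication.Theorems.ThinPackings.stub_transfer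

/-! ### Consistency: each named statement IS its registered stub (definitionally) -/

theorem cosetDesign_holds : CosetDesignStatement := stub_cosetDesign
theorem cosetTiles_holds : CosetTilesStatement := stub_cosetTiles
theorem blockTPP_holds : BlockTPPStatement := stub_blockTPP
theorem transfer_holds : TransferStatement := stub_transfer

/-! ### Name-keyed aliases of the four statements (the hypotheses of the composition; the skeleton audit admits a
hypothesis by the last name component of its head) -/
namespace Registered

/-- Alias of `CosetDesignStatement` keyed by the registered stub name. -/
abbrev stub_cosetDesign : Prop := CosetDesignStatement
/-- Alias of `CosetTilesStatement` keyed by the registered stub name. -/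
abbrev stub_cosetTiles : Prop := CosetTilesStatement
/-- Alias of `BlockTPPStatement` keyed by the registered stub name. -/
abbrev stub_blockTPP : Prop := BlockTPPStatement
/-- Alias of `TransferStatement` keyed by the registered stub name. -/
abbrev stub_transfer : Prop := TransferStatement

end Registered

/-! ## Proved glue: coset design + tiles + TPP ⟹ the thin field-arithmetic target `C⁺_a` -/

/-- From a coset design (heart), the exact A–C layer (tiles) and generic TPP, assemble a `LogFlatThin` witness:
same field, `x = z =` coset base points, `ζ i = ζ`; `MulSTPP` by the case split
diagonal ↦ TPP, (`i = j`, `σ = σ'`) ↦ cancel the common short-leg factor and apply the tile lemma, else ↦ (OFF). -/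
theorem logFlatThin_of_coset (hD : CosetDesignStatement) (hT : CosetTilesStatement) (hB : BlockTPPStatement) :
    LogFlatThin := by
  intro a ha0 ha1 η hη
  obtain ⟨p, F, iF, iFin, iAlg, ζ, u, v, L, s, g, h, y, ξ, S, hp, hp3, hS0, hSa, hζ, h1, h2, h3, hTPP, hξ,
    hnd, hoff, hsize⟩ := hD a ha0 ha1 η hη
  -- the coset base points
  set x : Fin L → F := fun i => s i + (algebraMap (ZMod p) F (g i) + algebraMap (ZMod p) F (h i) * ζ) with hx
  refine ⟨p, F, iF, iFin, iAlg, L, x, y, x, ξ, fun _ => ζ, S, hp, hp3, hS0, ?_, ?_, ?_, hSa, hsize⟩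
  · -- directions nonzero: `ξ i ≠ 0` given; `ζ ≠ 0` from the independence of `1, ζ, …`
    intro i
    haveI : Fact p.Prime := ⟨hp⟩
    refine ⟨hξ i, ?_⟩
    simpa using (h1 i).ne_zero 1
  · intro i c
    exact ⟨(hnd i c).1, (hnd i c).2.1, (hnd i c).2.2⟩
  · -- the multiplicative STPP, by cases
    intro i j k τ τ' σ σ' ρ ρ' hτ hτ' hρ hρ' hσ hσ' E
    by_cases hij : i = j
    · subst hij
      by_cases hss : σ = σ'
      · subst hss
        -- cancel the common (nonzero) short-leg factor and apply the tile lemma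
        have hb : y i + ξ i * algebraMap (ZMod p) F σ ≠ 0 := (hnd i σ).2.1
        have E' : (x i + algebraMap (ZMod p) F τ') * (x k + ζ * algebraMap (ZMod p) F ρ') =
            (x k + algebraMap (ZMod p) F τ) * (x i + ζ * algebraMap (ZMod p) F ρ) := by
          apply mul_left_cancel₀ hb
          calc (y i + ξ i * algebraMap (ZMod p) F σ) *
                ((x i + algebraMap (ZMod p) F τ') * (x k + ζ * algebraMap (ZMod p) F ρ'))
              = (x i + algebraMap (ZMod p) F τ') * (y i + ξ i * algebraMap (ZMod p) F σ) *
                  (x k + ζ * algebraMap (ZMod p) F ρ') := by ring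
            _ = (x k + algebraMap (ZMod p) F τ) * (y i + ξ i * algebraMap (ZMod p) F σ) *
                  (x i + ζ * algebraMap (ZMod p) F ρ) := E
            _ = (y i + ξ i * algebraMap (ZMod p) F σ) *
                  ((x k + algebraMap (ZMod p) F τ) * (x i + ζ * algebraMap (ZMod p) F ρ)) := by ring
        obtain ⟨hik, hττ, hρρ⟩ := hT p F ζ u v hζ L s g h h1 h2 h3 i k τ τ' ρ ρ' hτ hτ' hρ hρ' E'
        exact ⟨rfl, hik, hττ, rfl, hρρ⟩
      · by_cases hik : i = k
        · subst hik
          obtain ⟨hττ, hσσ, hρρ⟩ := hB p F (x i) (y i) (x i) (ξ i) ζ (hTPP i) τ τ' σ σ' ρ ρ' E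
          exact ⟨rfl, rfl, hττ, hσσ, hρρ⟩
        · exact absurd E (hoff i i k τ τ' σ σ' ρ ρ' hτ hτ' hρ hρ' hσ hσ' (Or.inr ⟨hik, hss⟩))
    · exact absurd E (hoff i j k τ τ' σ σ' ρ ρ' hτ hτ' hρ hρ' hσ hσ' (Or.inl hij))

/-! ## The composition: the four stubs imply the crux, BY NAME (kernel-checked; no `sorry` below) -/

/-- **`ThinPackings_of`** — the glue of the line: a coset design with good short legs (`stub_cosetDesign`), the
exact A–C layer (`stub_cosetTiles`) and generic TPP (`stub_blockTPP`) give the thin field-arithmetic target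
`LogFlatThin` (`logFlatThin_of_coset`), which `stub_transfer` packages into the crux. -/
theorem ThinPackings_of (h₁ : Registered.stub_cosetDesign) (h₂ : Registered.stub_cosetTiles)
    (h₃ : Registered.stub_blockTPP) (h₄ : Registered.stub_transfer) :
    Summit.MatrixMultiplication.MatrixMultiplication.Theses.ThinBlockAlpha.ThinPackings := by
  intro a ha0 ha1 η hη
  obtain ⟨p, F, iF, iFin, iAlg, L, x, y, z, ξ, ζ, S, hp, hp3, hS0, hdir, hnd, hmul, hSa, hsize⟩ :=
    logFlatThin_of_coset h₁ h₂ h₃ a ha0 ha1 η hη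
  obtain ⟨A, B, C, hS, hcard⟩ := h₄ p F L x y z ξ ζ S hp hS0 hdir hnd hmul
  classical
  refine ⟨Additive Fˣ, inferInstance, inferInstance, L, p - 1, S.card, A, B, C, hS, hcard, ?_, hSa, ?_⟩
  · omega
  · -- `|Additive Fˣ| = |Fˣ| = |F| − 1`
    have hH : Fintype.card (Additive Fˣ) = Fintype.card F - 1 := by
      rw [Fintype.card_congr (Additive.toMul (α := Fˣ)), Fintype.card_units]
    rw [hH]
    exact hsize

/-- Wiring check: the registered stubs feed `ThinPackings_of` as stated. -/
example : Summit.MatrixMultiplication.MatrixMultiplication.Theses.ThinBlockAlpha.ThinPackings :=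
  ThinPackings_of stub_cosetDesign stub_cosetTiles stub_blockTPP stub_transfer

/-! ## Sanity anchors against the landed Negative lemmas (kernel-checked, no `sorry`)

The crux's necessities proved by the disprover apply to ANY witness, in particular to what `stub_transfer` outputs:
`N^{a−η} ≤ L` and `M ≤ N(N^η − 1) + 1` (`Negative.rpow_sub_le_L`, `Negative.M_le`).  We restate the second as the
design-side reading used in the line card ("`p − 1 ≥ (2 − o(1))^{1/η}` once `a > 0`"): nothing to prove here beyond
citing the landed names, which this `example` pins (it fails to elaborate if they move). -/
example := @Summit.MatrixMultiplication.MatrixMultiplication.Theorems.ThinPackings.Negative.M_le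
example := @Summit.MatrixMultiplication.MatrixMultiplication.Theorems.ThinPackings.Negative.rpow_sub_le_L
example := @Summit.MatrixMultiplication.MatrixMultiplication.Theorems.ThinPackings.Negative.not_thinPackingsExact

end Summit.MatrixMultiplication.MatrixMultiplication.Cruxes.ThinPackings.LogFlatCyclicDesigns
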